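import Summits.BirchSwinnertonDyer.BirchSwinnertonDyer.Theorems.PrintCf2RamifiedOffTYZMoverBlockFormSixOfValue
import Summits.BirchSwinnertonDyer.BirchSwinnertonDyer.Theorems.PrintCf2RamifiedOffTYZMoverBlockIndex
import Summits.BirchSwinnertonDyer.BirchSwinnertonDyer.Theorems.PrintCf2RamifiedOffTYZMoverSumBlocksSixBlocks
import Literature.NumberTheory.EllipticCurves.Smith2016.CongruentNumberGenusDeterminantRowsTwoThreeUnconditional
import HarnessLib

/-!
# Crux `PrintCf2.RamifiedOffTYZOfFacts` (stmt-BirchSwinnertonDyer-20509), line `offtyz-v7`, LEAD cycle 14 (cruxlead-20509 g13):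
# THE EVEN SQUARE FORM, BLOCK LEVEL — every block term of g8's even square formula as an explicit `𝔽₂`-form in the bits of a GENERAL `g`,
# indexed on the prime tuple (`n = 2p₁⋯p_k`), and the cofactor parities of sub-blocks as Monsky determinants

THEOREMS ONLY (no `def`, no named fact, no `sorry`), `--supports stmt-BirchSwinnertonDyer-20509` (C⁺ = item 23431 even sector; the `s = 1` even
stratum of 23432).  The block-level half of the closed-form reduction «`[g·g moves P(n)]` = `evenSquareFormMatrix p` at the bits of `g`» behind the
EVEN Ω-IDENTITY (crux workfiles `Lines/offtyz_v7_EvenOmega.lean`, `Lines/offtyz_v7_RegimeFreeLaw.md` §5b; definitions `…EvenOmegaDefs`):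
* §1 `sqMotion_five_eq_sum_blockRho_mul_bits_even` — g7's block form on `Fin k` (`MoverBlockIndex.sqMotion_eq_sum_blockRho_mul_bits`) for EVEN
  `n = 2∏pᵢ`: on a displayed block `d_T ≡ 5 (mod 8)`, `χ_{d_T}(g) = Σ_{i∈T} blockRho p T i · [g moves i√−pᵢ]` for every `g` fixing `√−d_T`;
* §2 `sqMotion_six_eq_sum_kerSum_mul_bits` — the REGIME-FREE even block law (p743258/p743484) on `Fin k`: on a block `2d_S ≡ 6 (mod 8)`,
  `χ_{2d_S}(g) = Σ_{i∈S} κ^S_i · [g moves i√−pᵢ] + κ^S_∞ · [g moves i√−2]`, `κ^S` the kernel sum of `N_S = [[A_S + D₋₂, z_S],[0,0]]` read back on `S`;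
* §3 `bit_sqrtNeg_blockProd`, `bit_sqrtNeg_two_mul_blockProd` — the stabiliser indicators: `[g moves √−d_S] = x_im + Σ_{i∈S} x_i`,
  `[g moves √−2d_S] = x_im + x_2 + Σ_{i∈S} x_i`;
* §4 `scriptL_natAbs_blockProd_eq_det`, `scriptL_natAbs_two_mul_blockProd_eq_det` — `|𝓛(d_X)| ≡ det M_odd(X)` (`d_X ≡ 1, 3 (mod 8)`) and
  `|𝓛(2d_X)| ≡ det M_even(X)` (`d_X ≡ 1 (mod 4)`), relative to TYZ Thm 1.1 (Smith rows 1–3 and Monsky are tree theorems).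
BSD is not proved by any of this; no class is closed by this file.

References: [cite: TianYuanZhang2017, Thm. 1.1 (p0002 L90–L99), §3.1 (p0011 L1–L13, L53–L73), Prop. 3.2 (1)(2), Thm. 3.6 (1)(2), proof of Lemma 3.21 (p0020 L27–L63)];
[cite: HeathBrown1994SelmerCongruentII, Appendix (Monsky), typescript p. 39 L10 – p. 41 L36]; [cite: Smith2016CongruentDensity, Thm. 2.2 rows 1–3];
[cite: Cox2013, §5.C Lemma 5.19, §7.D, §9.A]; [cite: Stevenhagen1995RedeiMatrices, §2].
-/

noncomputable section

open scoped Classical NumberField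

open WeierstrassCurve WeierstrassCurve.Affine Finset Matrix Literature.NumberTheory.EllipticCurves
  Literature.NumberTheory.EllipticCurves.TianYuanZhang2017
  Literature.NumberTheory.EllipticCurves.TianYuanZhang2017.W2
  Literature.NumberTheory.EllipticCurves.HeathBrown1994
  Literature.NumberTheory.EllipticCurves.HeathBrown1994.Families
  Literature.NumberTheory.EllipticCurves.Smith2016
  Literature.NumberTheory.EllipticCurves.MonskySelmerParity
  Literature.NumberTheory.QuadraticFields.RingClass
  Literature.NumberTheory.QuadraticFields
  Literature.LinearAlgebra.Matrix
  Summit.BirchSwinnertonDyer.Rank1Residual.P2.GenusPeriodTransferLayer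
  Summit.BirchSwinnertonDyer.Rank1Residual.P2.ThetaDescent
  Summit.BirchSwinnertonDyer.PrintCf2.QForm

set_option autoImplicit false

namespace Summit.BirchSwinnertonDyer.PrintCf2.MoverAssembly

variable {k : ℕ} (p : Fin k → ℕ) (hp : ∀ i, (p i).Prime) (hodd : ∀ i, Odd (p i)) (hinj : Function.Injective p)

variable {n : ℕ} (D : GenusPointData n)

/-! ## §1 Odd blocks `≡ 5 (mod 8)` of an even `n`, on `Fin k` -/

include hp hinj in
/-- The prime-form Frobenius hypothesis of an odd block `d_T = ∏_{i∈T} pᵢ` of `n = 2p₁⋯p_k` yields the indexed form on `blockPrimes p T`.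
[cite: Cox2013, §5.C Lemma 5.19] [cite: TianYuanZhang2017, Prop. 3.2 (1)] -/
theorem frobenius_indexed_of_prime_form_even (hn : n = 2 * ∏ i, p i) (T : Finset (Fin k)) {ΓH' : Subgroup (D.H ≃ₐ[ℚ] D.H)}
    (hF : ∀ q : ℕ, q.Prime → q ∣ (∏ i ∈ T, p i) → ∃ φ : D.H ≃ₐ[ℚ] D.H,
      φ (D.sqrtNeg (∏ i ∈ T, p i)) = D.sqrtNeg (∏ i ∈ T, p i) ∧ φ * φ ∈ ΓH' ∧
        φ D.im = (jacobiSym (-1) q) • D.im ∧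
        ∀ r : ℕ, r.Prime → r ∣ n → r ≠ q → φ (D.sqrtNeg r) = (jacobiSym (-(r : ℤ)) q) • D.sqrtNeg r) :
    ∀ j : Fin T.card, ∃ φ : D.H ≃ₐ[ℚ] D.H,
      φ (D.sqrtNeg (∏ i ∈ T, p i)) = D.sqrtNeg (∏ i ∈ T, p i) ∧ φ * φ ∈ ΓH' ∧
        φ D.im = (jacobiSym (-1) (blockPrimes p T j)) • D.im ∧
        ∀ i, i ≠ j → φ (D.sqrtNeg (blockPrimes p T i)) =
          (jacobiSym (-(blockPrimes p T i : ℤ)) (blockPrimes p T j)) • D.sqrtNeg (blockPrimes p T i) := by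
  intro j
  have hjT : ((T.orderIsoOfFin rfl).toEquiv j : Fin k) ∈ T := ((T.orderIsoOfFin rfl).toEquiv j).2
  obtain ⟨φ, h1, h2, h3, h4⟩ := hF (blockPrimes p T j) (hp _) (by rw [blockPrimes_apply]; exact dvd_prod_of_mem p hjT)
  refine ⟨φ, h1, h2, h3, fun i hij => h4 _ (hp _) ?_ ?_⟩
  · rw [hn, blockPrimes_apply]; exact Dvd.dvd.mul_left (dvd_prod_of_mem p (mem_univ _)) 2
  · exact fun h => hij (blockPrimes_injective p hinj T h)

include hp hodd hinj in
/-- **Odd block form on `Fin k`, even `n`.**  `n = 2p₁⋯p_k` square-free, `T ⊆ {1..k}` with `d_T ≡ 5 (mod 8)` a displayed block (`CMBlockSpec`,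
`RingClassTwoBlockSpec`, Frobenius hypothesis in prime form); then for every `g` fixing `√−d_T`:
`[(g*g)^{g(d_T)}σ⁻¹ ∈ Gal(ℍ′_n/H′_{d_T})] = Σ_{i∈T} blockRho p T i · [g moves i√−pᵢ]`.
[cite: TianYuanZhang2017, §3.1 (p0011 L1–L13, L53–L64), Prop. 3.2 (1), Thm. 3.6 (1), proof of Lemma 3.21 (p0020 L50–L63)]
[cite: Cox2013, §5.C Lemma 5.19, §9.A] [cite: Stevenhagen1995RedeiMatrices, §2 Thm. 1] -/
theorem sqMotion_five_eq_sum_blockRho_mul_bits_even (hn : n = 2 * ∏ i, p i) (T : Finset (Fin k)) (hT : (∏ i ∈ T, p i) % 8 = 5)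
    {z : APoint D.H} {Φ : Finset (D.H ≃ₐ[ℚ] D.H)} {ΓH ΓH' : Subgroup (D.H ≃ₐ[ℚ] D.H)} {σ c : D.H ≃ₐ[ℚ] D.H}
    (h : D.CMBlockSpec (∏ i ∈ T, p i) z Φ ΓH ΓH' σ c) {ρ : D.galK (∏ i ∈ T, p i) →* RingClassGroup (GenusField (∏ i ∈ T, p i)) 2}
    (hρ : D.RingClassTwoBlockSpec (∏ i ∈ T, p i) ΓH ΓH' ρ)
    (hF : ∀ q : ℕ, q.Prime → q ∣ (∏ i ∈ T, p i) → ∃ φ : D.H ≃ₐ[ℚ] D.H,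
      φ (D.sqrtNeg (∏ i ∈ T, p i)) = D.sqrtNeg (∏ i ∈ T, p i) ∧ φ * φ ∈ ΓH' ∧
        φ D.im = (jacobiSym (-1) q) • D.im ∧
        ∀ r : ℕ, r.Prime → r ∣ n → r ≠ q → φ (D.sqrtNeg r) = (jacobiSym (-(r : ℤ)) q) • D.sqrtNeg r)
    (g : D.H ≃ₐ[ℚ] D.H) (hg : g (D.sqrtNeg (∏ i ∈ T, p i)) = D.sqrtNeg (∏ i ∈ T, p i)) :
    (if (g * g) ^ gK (∏ i ∈ T, p i) * σ⁻¹ ∈ ΓH' then (1 : ZMod 2) else 0) =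
      ∑ i ∈ T, blockRho p T i * (if g (D.im * D.sqrtNeg (p i)) = D.im * D.sqrtNeg (p i) then (0 : ZMod 2) else 1) := by
  have hsq : Squarefree n := by
    rw [hn, ← prod_cons_two_eq p]
    exact squarefree_prod_of_injective _ (prime_cons_two p hp) (injective_cons_two p hodd hinj)
  have hd : (∏ i ∈ T, p i) ∈ n.divisors := by
    rw [hn]
    exact Nat.mem_divisors.mpr ⟨Dvd.dvd.mul_left (Finset.prod_dvd_prod_of_subset _ _ _ (subset_univ T)) 2,
      mul_ne_zero two_ne_zero (Finset.prod_ne_zero_iff.mpr fun i _ => (hp i).ne_zero)⟩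
  rw [sqMotion_eq_kerSum_dotProduct_bits D (blockPrimes p T) (blockPrimes_prime p hp T) (blockPrimes_odd p hodd T)
    (blockPrimes_injective p hinj T) hsq hd hT (prod_blockPrimes p T) h hρ (frobenius_indexed_of_prime_form_even p hp hinj D hn T hF) g hg]
  exact sum_kerSum_blockPrimes_eq_sum_blockRho p T (fun r => if g (D.im * D.sqrtNeg r) = D.im * D.sqrtNeg r then 0 else 1)

/-! ## §2 Even blocks `2d_S ≡ 6 (mod 8)`: the regime-free law on the sub-tuple -/

include hp hodd hinj in
/-- **Even block form on the sub-tuple, ALL regimes.**  `n = 2p₁⋯p_k`, `S ⊆ {1..k}` with `d_S ≡ 3 (mod 4)` (so `2d_S ≡ 6 (mod 8)`), the block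
clauses of `CMPointRingClassFrobeniusValuePrinted`; then for every `g` fixing `√−2d_S`:
`[(g*g)^{g(2d_S)}σ⁻¹ ∈ Gal(ℍ′_n/H′_{2d_S})] = Σ_t κ^S_t · [g moves i√−q_t] + κ^S_∞ · [g moves i√−2]`, `q = blockPrimes p S`, `κ^S = kerSum N_S`,
`N_S = [[A_S + D₋₂, z_S],[0,0]]` — NO genus-regime hypothesis (regime-free law p743258/p743484).
[cite: TianYuanZhang2017, §3.1 (p0011 L1–L13, L53–L73), Prop. 3.2 (2), Thm. 3.6 (2), proof of Lemma 3.21 (p0020 L27–L63)] [cite: Cox2013, §5.C Lemma 5.19, §7.D, §9.A] -/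
theorem sqMotion_six_eq_sum_kerSum_mul_bits (hn : n = 2 * ∏ i, p i) (S : Finset (Fin k)) (hS : (∏ i ∈ S, p i) % 4 = 3)
    {zf : ℕ → APoint D.H} {Φf : ℕ → Finset (D.H ≃ₐ[ℚ] D.H)} {ΓHf ΓH'f : ℕ → Subgroup (D.H ≃ₐ[ℚ] D.H)}
    {σf θf : ℕ → (D.H ≃ₐ[ℚ] D.H)} {cf : D.H ≃ₐ[ℚ] D.H}
    {ρ₂ : (d : ℕ) → (D.galK d →* RingClassGroup (GenusField d) 2)}
    {ρ₄ : (d : ℕ) → (D.galK d →* RingClassGroup (GenusField d) 4)}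
    (hb : ∀ d ∈ n.divisors,
      ((d % 8 = 5 ∨ d % 8 = 6) → D.CMBlockSpec d (zf d) (Φf d) (ΓHf d) (ΓH'f d) (σf d) cf) ∧
      (d % 8 = 6 → D.ThetaBlockSpec d (zf d) (ΓHf d) (ΓH'f d) (σf d) (θf d)) ∧
      (d % 8 = 7 → D.SevenBlockSpec d) ∧
      (d % 8 = 5 → D.RingClassTwoBlockSpec d (ΓHf d) (ΓH'f d) (ρ₂ d)) ∧
      (d % 8 = 6 → D.RingClassFourBlockSpec d (ΓHf d) (ΓH'f d) (ρ₄ d)) ∧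
      (d % 8 = 5 → D.FrobeniusTwoBlockSpec d (ΓH'f d)) ∧
      (d % 8 = 6 → D.FrobeniusFourBlockSpec d (ΓH'f d)) ∧
      (d % 8 = 6 → D.FrobeniusFourValueBlockSpec d (ΓH'f d) (ρ₄ d)))
    (g : D.H ≃ₐ[ℚ] D.H) (hg : g (D.sqrtNeg (2 * ∏ i ∈ S, p i)) = D.sqrtNeg (2 * ∏ i ∈ S, p i)) :
    (if (g * g) ^ gK (2 * ∏ i ∈ S, p i) * (σf (2 * ∏ i ∈ S, p i))⁻¹ ∈ ΓH'f (2 * ∏ i ∈ S, p i) then (1 : ZMod 2) else 0) =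
      (∑ t : Fin S.card,
        kerSum (Matrix.fromBlocks (legendreMatrix (blockPrimes p S) + legendreDiagonal (blockPrimes p S) (-2))
            (Matrix.of fun j (_ : Unit) => addLegendreSym 2 (blockPrimes p S j))
            (0 : Matrix Unit (Fin S.card) (ZMod 2)) (0 : Matrix Unit Unit (ZMod 2))) (Sum.inl t) *
          (if g (D.im * D.sqrtNeg (blockPrimes p S t)) = D.im * D.sqrtNeg (blockPrimes p S t) then (0 : ZMod 2) else 1)) +
      kerSum (Matrix.fromBlocks (legendreMatrix (blockPrimes p S) + legendreDiagonal (blockPrimes p S) (-2))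
            (Matrix.of fun j (_ : Unit) => addLegendreSym 2 (blockPrimes p S j))
            (0 : Matrix Unit (Fin S.card) (ZMod 2)) (0 : Matrix Unit Unit (ZMod 2))) (Sum.inr ()) *
        (if g (D.im * D.sqrtNeg 2) = D.im * D.sqrtNeg 2 then (0 : ZMod 2) else 1) := by
  have hsq : Squarefree n := by
    rw [hn, ← prod_cons_two_eq p]
    exact squarefree_prod_of_injective _ (prime_cons_two p hp) (injective_cons_two p hodd hinj)
  have hd : 2 * ∏ i ∈ S, p i ∈ n.divisors := twice_blockProd_mem_divisors p hp hn S
  have hd8 : (2 * ∏ i ∈ S, p i) % 8 = 6 := by omega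
  have hprod : 2 * ∏ t, blockPrimes p S t = 2 * ∏ i ∈ S, p i := by rw [prod_blockPrimes p S]
  rw [sqMotion_eq_kerSum_dotProduct_bits_six_of_clauses D (blockPrimes p S) (blockPrimes_prime p hp S) (blockPrimes_odd p hodd S)
    (blockPrimes_injective p hinj S) hsq hb hd hd8 hprod g hg, Fintype.sum_sum_type]
  simp only [Sum.elim_inl, Sum.elim_inr, Finset.univ_unique, PUnit.default_eq_unit, Finset.sum_singleton]

/-! ## §3 The stabiliser indicators as bit sums -/

include hp in
/-- **`[g moves √−d_S] = [g moves i] + Σ_{t} [g moves i√−q_t]`** (`q = blockPrimes p S`) for an odd sub-block `d_S` of `n = 2p₁⋯p_k`.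
[cite: TianYuanZhang2017, §3.1 (p0011 L60–L66)] -/
theorem bit_sqrtNeg_blockProd (hn : n = 2 * ∏ i, p i) (S : Finset (Fin k)) (g : D.H ≃ₐ[ℚ] D.H) :
    (if g (D.sqrtNeg (∏ i ∈ S, p i)) = D.sqrtNeg (∏ i ∈ S, p i) then (0 : ZMod 2) else 1) =
      (if g D.im = D.im then (0 : ZMod 2) else 1) +
        ∑ t : Fin S.card, (if g (D.im * D.sqrtNeg (blockPrimes p S t)) = D.im * D.sqrtNeg (blockPrimes p S t) then (0 : ZMod 2) else 1) := by
  have hd : (∏ i ∈ S, p i) ∈ n.divisors := by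
    rw [hn]
    exact Nat.mem_divisors.mpr ⟨Dvd.dvd.mul_left (Finset.prod_dvd_prod_of_subset _ _ _ (subset_univ S)) 2,
      mul_ne_zero two_ne_zero (Finset.prod_ne_zero_iff.mpr fun i _ => (hp i).ne_zero)⟩
  exact bit_sqrtNeg_eq_bit_im_add_sum D (blockPrimes p S) hd (prod_blockPrimes p S) g

include hp in
/-- **`[g moves √−2d_S] = [g moves i] + [g moves i√−2] + Σ_{t} [g moves i√−q_t]`** for an even sub-block `2d_S` of `n = 2p₁⋯p_k`.
[cite: TianYuanZhang2017, §3.1 (p0011 L60–L66)] -/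
theorem bit_sqrtNeg_two_mul_blockProd (hn : n = 2 * ∏ i, p i) (S : Finset (Fin k)) (g : D.H ≃ₐ[ℚ] D.H) :
    (if g (D.sqrtNeg (2 * ∏ i ∈ S, p i)) = D.sqrtNeg (2 * ∏ i ∈ S, p i) then (0 : ZMod 2) else 1) =
      (if g D.im = D.im then (0 : ZMod 2) else 1) + (if g (D.im * D.sqrtNeg 2) = D.im * D.sqrtNeg 2 then (0 : ZMod 2) else 1) +
        ∑ t : Fin S.card, (if g (D.im * D.sqrtNeg (blockPrimes p S t)) = D.im * D.sqrtNeg (blockPrimes p S t) then (0 : ZMod 2) else 1) := by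
  have hd : 2 * ∏ i ∈ S, p i ∈ n.divisors := twice_blockProd_mem_divisors p hp hn S
  have hprod : ∏ j, (Fin.cons 2 (blockPrimes p S) : Fin (S.card + 1) → ℕ) j = 2 * ∏ i ∈ S, p i := by
    rw [prod_cons_two_eq, prod_blockPrimes]
  rw [bit_sqrtNeg_eq_bit_im_add_sum D (Fin.cons 2 (blockPrimes p S)) hd hprod g, Fin.sum_univ_succ, Fin.cons_zero, add_assoc]
  simp only [Fin.cons_succ]

/-! ## §4 Cofactor parities of sub-blocks as Monsky determinants -/

include hp hodd hinj in
/-- **`|𝓛(d_X)| ≡ det M_odd(X) (mod 2)`** for a non-empty sub-block `d_X ≡ 1` or `3 (mod 8)` of `n = 2p₁⋯p_k`, relative to TYZ Thm 1.1 (Smith rows 1, 3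
and Monsky's odd formula are tree theorems). [cite: TianYuanZhang2017, Thm. 1.1 (p0002 L90–L99)] [cite: Smith2016CongruentDensity, Thm. 2.2 rows 1, 3]
[cite: HeathBrown1994SelmerCongruentII, Appendix (Monsky), typescript p. 39 L27–L33] -/
theorem scriptL_natAbs_blockProd_eq_det (h11 : thm11_parity_of_scriptL) (hn : n = 2 * ∏ i, p i) (hLs : D.scriptLSpec)
    (X : Finset (Fin k)) (hX : X.Nonempty) (h13 : (∏ i ∈ X, p i) % 8 = 1 ∨ (∏ i ∈ X, p i) % 8 = 3) :
    (((D.scriptL (∏ i ∈ X, p i)).natAbs : ℕ) : ZMod 2) = (monskyMatrixOdd (blockPrimes p X)).det := by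
  set m := ∏ i ∈ X, p i with hm
  set q : Fin X.card → ℕ := blockPrimes p X with hq
  have hqprod : ∏ t, q t = m := prod_blockPrimes p X
  have hqp : ∀ t, (q t).Prime := blockPrimes_prime p hp X
  have hqodd : ∀ t, Odd (q t) := blockPrimes_odd p hodd X
  have hqinj : Function.Injective q := blockPrimes_injective p hinj X
  have hn0 : n ≠ 0 := by rw [hn]; exact mul_ne_zero two_ne_zero (Finset.prod_ne_zero_iff.mpr fun i _ => (hp i).ne_zero)
  have hdvd : m ∣ n := by rw [hn]; exact Dvd.dvd.mul_left (Finset.prod_dvd_prod_of_subset _ _ _ (subset_univ X)) 2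
  have hmdiv : m ∈ n.divisors := Nat.mem_divisors.mpr ⟨hdvd, hn0⟩
  have hm1 : 1 < m := by
    obtain ⟨i, hi⟩ := hX
    rw [hm, ← Finset.mul_prod_erase _ _ hi]
    have h1 := (hp i).one_lt
    have h2 := blockProd_pos p hp (X.erase i)
    nlinarith
  have hmsq : Squarefree m := by rw [← hqprod]; exact squarefree_prod_of_injective q hqp hqinj
  obtain ⟨L, hL, hLpar⟩ := h11 m hmsq (by rcases h13 with h | h; exact Or.inl h; exact Or.inr (Or.inr h)) GenusField
    (isGenusFieldFamily_genusField m)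
  have hLD : IsScriptL m (D.scriptL m) := hLs m hmdiv hm1
  have hpar : (((D.scriptL m).natAbs : ℕ) : ZMod 2) = (L : ZMod 2) := by
    rw [natCast_natAbs_zmod_two]
    rcases LevelTwo.eq_or_eq_neg_of_isScriptL hLD hL with h | h
    · rw [h]
    · rw [h, Int.cast_neg, ZMod.neg_eq_self_mod_two]
  rw [hpar, hLpar]
  have hiff : Odd (genusSum₁ m fun d => genusClassNumber (GenusField d)) ↔ (monskyMatrixOdd q).det = 1 := by
    rcases h13 with h1 | h3
    · rw [← hqprod, ← card_selmerGroup_two_eq_four_iff_odd_genusSum₁ q hqp hqodd hqinj (by rw [hqprod]; exact h1),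
        card_selmerGroup_two_eq_four_iff_det_monskyMatrixOdd q hqp hqodd hqinj]
    · rw [← hqprod, ← card_selmerGroup_two_eq_four_iff_odd_genusSum₁_three q hqp hqodd hqinj (by rw [hqprod]; exact h3),
        card_selmerGroup_two_eq_four_iff_det_monskyMatrixOdd q hqp hqodd hqinj]
  have hval : ∀ x : ZMod 2, x = 0 ∨ x = 1 := by decide
  rcases hval (monskyMatrixOdd q).det with h0 | h1
  · rw [h0]
    have hno : ¬ Odd (genusSum₁ m fun d => genusClassNumber (GenusField d)) := fun ho => by
      rw [hiff, h0] at ho; exact zero_ne_one ho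
    rw [odd_iff_natCast_zmod_two_eq_one] at hno
    rcases hval ((genusSum₁ m fun d => genusClassNumber (GenusField d) : ℕ) : ZMod 2) with h | h
    · exact h
    · exact absurd h hno
  · rw [h1]
    exact (odd_iff_natCast_zmod_two_eq_one _).mp (hiff.mpr h1)

include hp hodd hinj in
/-- **`|𝓛(2d_X)| ≡ det M_even(X) (mod 2)`** for a sub-block `d_X ≡ 1 (mod 4)` of `n = 2p₁⋯p_k` (`X = ∅` allowed: `|𝓛(2)| = 1 = det` of the empty
matrix), relative to TYZ Thm 1.1 (Smith row 2 and Monsky's even formula are tree theorems).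
[cite: TianYuanZhang2017, Thm. 1.1 (p0002 L90–L99)] [cite: Smith2016CongruentDensity, Thm. 2.2 row 2] [cite: HeathBrown1994SelmerCongruentII, Appendix (Monsky), typescript p. 41 L20–L36] -/
theorem scriptL_natAbs_two_mul_blockProd_eq_det (h11 : thm11_parity_of_scriptL) (hn : n = 2 * ∏ i, p i) (hLs : D.scriptLSpec)
    (X : Finset (Fin k)) (h1 : (∏ i ∈ X, p i) % 4 = 1) :
    (((D.scriptL (2 * ∏ i ∈ X, p i)).natAbs : ℕ) : ZMod 2) = (monskyMatrixEven (blockPrimes p X)).det := by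
  set m := 2 * ∏ i ∈ X, p i with hm
  set q : Fin X.card → ℕ := blockPrimes p X with hq
  have hqprod : ∏ t, q t = ∏ i ∈ X, p i := prod_blockPrimes p X
  have hqp : ∀ t, (q t).Prime := blockPrimes_prime p hp X
  have hqodd : ∀ t, Odd (q t) := blockPrimes_odd p hodd X
  have hqinj : Function.Injective q := blockPrimes_injective p hinj X
  have hp2 : ∀ i, p i ≠ 2 := ne_two_of_odd p hodd
  have hmdiv : m ∈ n.divisors := twice_blockProd_mem_divisors p hp hn X
  have hm1 : 1 < m := by have h2 := blockProd_pos p hp X; rw [hm]; omega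
  have hm2 : m % 8 = 2 := by rw [hm]; omega
  have hmsq : Squarefree m := by
    rw [hm, ← hqprod, ← prod_cons_two_eq q]
    exact squarefree_prod_of_injective _ (prime_cons_two q hqp) (injective_cons_two q hqodd hqinj)
  obtain ⟨L, hL, hLpar⟩ := h11 m hmsq (Or.inr (Or.inl hm2)) GenusField (isGenusFieldFamily_genusField m)
  have hLD : IsScriptL m (D.scriptL m) := hLs m hmdiv hm1
  have hpar : (((D.scriptL m).natAbs : ℕ) : ZMod 2) = (L : ZMod 2) := by
    rw [natCast_natAbs_zmod_two]
    rcases LevelTwo.eq_or_eq_neg_of_isScriptL hLD hL with h | h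
    · rw [h]
    · rw [h, Int.cast_neg, ZMod.neg_eq_self_mod_two]
  rw [hpar, hLpar]
  have hiff : Odd (genusSum₁ m fun d => genusClassNumber (GenusField d)) ↔ (monskyMatrixEven q).det = 1 := by
    rw [hm, ← hqprod, ← card_selmerGroup_two_eq_four_iff_odd_genusSum₁_two q hqp hqodd hqinj (by rw [hqprod]; exact h1),
      card_selmerGroup_two_eq_four_iff_det_monskyMatrixEven q hqp hqodd hqinj]
  have hval : ∀ x : ZMod 2, x = 0 ∨ x = 1 := by decide
  rcases hval (monskyMatrixEven q).det with h0 | h1'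
  · rw [h0]
    have hno : ¬ Odd (genusSum₁ m fun d => genusClassNumber (GenusField d)) := fun ho => by
      rw [hiff, h0] at ho; exact zero_ne_one ho
    rw [odd_iff_natCast_zmod_two_eq_one] at hno
    rcases hval ((genusSum₁ m fun d => genusClassNumber (GenusField d) : ℕ) : ZMod 2) with h | h
    · exact h
    · exact absurd h hno
  · rw [h1']
    exact (odd_iff_natCast_zmod_two_eq_one _).mp (hiff.mpr h1')

end Summit.BirchSwinnertonDyer.PrintCf2.MoverAssembly

end
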